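import Summits.BirchSwinnertonDyer.BirchSwinnertonDyer.Theorems.SmallImageMuTransferMuTransferX9KolyvaginCocycleMeetingPoint
import Literature.NumberTheory.GaloisRepresentations.LocalGaloisGroupProofs
import HarnessLib

/-!
# K6 crux `MuTransferX9` (stmt-BirchSwinnertonDyer-19276), skeleton v6 stub `stub_stepsTwoFourOdd`:
# the Kolyvagin cocycle AT THE MEETING POINT TOGETHER WITH ITS VALUE — the «hVal» input of the
# assembly `StepsTwoFour.stub_stepsTwoFourOdd_of (hG3a) (hVal)` DISCHARGED down to the class-level
# norm relation of the tame class (koly's «G3a» output)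

Cell `b2b-bsdres`, seat `x10` GEN 39 (N2 = X10b@3 class lead, serving the K6 route
`SmallImageMuTransfer` of cell `bsd-smallim`; bsd-smallim STATUS l.324 RULING (i) «the DISCHARGE of
hVal»).  THEOREMS ONLY (no definition, no named fact, no `sorry`).  HONEST FRAMING: helper toward
the registered stub `stub_stepsTwoFourOdd` of crux 19276 (skeleton v6 `a90a661b046bb403` / v6d);
closes nothing; nothing is booked; class X10b stays CONSTRUCTION-SHAPED / NEEDS X_A3 and class X9
TYPED. PARTITION (D-0054): X9 (A4) × p ∈ {5, 7} · X10b∧¬Surj (A5) × p = 3 — helper; closes NONE.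

## What, and why a separate theorem

k6-g3's `KolyvaginTwist.exists_kolyvaginCocycle_meetingPoint` (p458422) produces, from a tame
cocycle `y` on `N = Gal(ℚ̄/ℚ(μ_ℓ))` at level `J` with (I1) integrality and (I2) vanishing norm, the
data `(σ, τq, Φ)` of the G3/G4 meeting point with the value clause `Φ(res τq) = −a` for EVERY norm
witness `a`.  The assembly of `stub_stepsTwoFourOdd` needs the value in the stub's currency
(`U(S)·S^{e'+1}·Φ'(Fr)`), which by MU-TRANSFER-PROOF §3 (3.1) comes from the norm relation ONE LEVEL
UP (`L = p·e ≥ J + e`): `(φ̃ − 1)·a' = −P·c₁(φ)` (k6-g3 `rho_sub_eq_of_norm_witness`) followed by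
the division step (`…X9KolyvaginValueDivision`).  That computation needs (a) the generator `σ`
CHOSEN INSIDE the meeting point together with its covering / injectivity properties (`hcov`, `hinj`
of `exists_generator_mem_inertia`, not exported by p458422), to turn a CLASS-LEVEL norm relation
`cor_N [y'] = [ψ']` into a cocycle-level norm witness, (b) a Frobenius `φ ∈ N` of the distinguished
prime at which to evaluate (3.1), and (c) the witness transported from level `L` to level `J`
(`norm_witness_map`).  So the value cannot be bolted onto p458422 from outside; this file REDOES the
meeting point with the level-`L` input and exports, in addition to p458422's clauses:

* koly's binder **`hgen`** for `τq`: `χ̄_ℓ^{ℚ_q}(τq)` generates `(ℤ/ℓ)ˣ` (from `hcov`);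
* a LOCAL arithmetic Frobenius **`r` of `ℚ_q` with `res r ∈ N`** (`res r₀` corrected by a power of
  `τq`; Frobenius × inertia = Frobenius, `IsFrobPow.inertia_mul`);
* THE KEY RELATION **`∃ a' : 𝒯_L, Φ(res τq) = −(a' mod T^J) ∧ (res r)·a' − a' = −ψ'(res r)`**.

INPUT SHAPE (agnostic of the exact Euler-factor operator koly g9 / lur-a print): the level-`L` tame
cocycle `y'` with (I1) at level `L`, ANY global level-`L` cocycle `ψ'` with the class-level norm
relation `hnorm : cor_N [y'] = [ψ']` and `hψJ`: the truncation of `ψ'` to level `J` vanishes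
pointwise.  The consumer takes `ψ' := κ.pushCocycle ρ hM L Pφ c₁` with `[c₁] = ξ_L = (I.redTower
s).1 L` and `Pφ = P̄_{Fr}(φ̃^{∓1}) = S^{2e}·(unit)` (`J = 2e`), converting koly's `cor_N [y'] =
H¹(Pφ) ξ_L` by `ZpExtension.map_oneCocycleClass_twist`.  The division step and the coboundary
correction `[c₁(res r)]_J ↝ Φ'(res r)` are pure `𝒯_J`-algebra on top of the key relation (k6-g3
`neg_castLE_eq_shiftEnd_pow_aeval_castLE`, x9 `twistModP_apply_sub_self_mem_range_of_depth`) and are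
left to the adapter file once the assembler's `hVal` text is frozen (bsd-smallim STATUS l.330).

References: HOME/koly/MU-TRANSFER-PROOF.md §3 (Lemma 2, (3.1), VALUES), §5 STEP 3; K. Rubin, *Euler
Systems* (2000) §4.4 (Def. 4.4.4, Lemma 4.4.2), Thm. 4.5.1 [Rubin2000]; B. Perrin-Riou, Ann. Inst.
Fourier 48 (1998) §3.1.2, Prop. 3.1.6 [PerrinRiou1998AIF]; J. Tate, *Number theoretic background*
(Corvallis 1979) (1.4.1) [TateCorvallis1979].
-/

-- the summit and its single problem are both named `BirchSwinnertonDyer` (registry layout D-0017)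
set_option linter.dupNamespace false
set_option autoImplicit false

noncomputable section

open CategoryTheory Function Finset
open scoped NumberField Pointwise
open Field IsDedekindDomain NumberField
open Literature.NumberTheory.GaloisRepresentations
open Literature.NumberTheory.GaloisRepresentations.IsNonarchimedeanLocalField
open Literature.NumberTheory.EllipticCurves
open Literature.NumberTheory.EllipticCurves.ZpExtension
open Rat.HeightOneSpectrum
open Summit.BirchSwinnertonDyer.Rank1Residual.GaloisImage
open Summit.BirchSwinnertonDyer.Rank1Residual.GaloisImage.CyclotomicLevel.Rat

namespace Summit.BirchSwinnertonDyer.BirchSwinnertonDyer.Rank1Residual.KolyvaginTwist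

variable {p : ℕ} [Fact p.Prime] {M : Type} [AddCommGroup M] [TopologicalSpace M]
  [DiscreteTopology M] (κ : ZpExtension ℚ p) (ρ : DiscreteGaloisModule ℚ M)
  (hM : ∀ m : M, p • m = 0) (J : ℕ)

/-- **A local Frobenius of `ℚ_q` restricting into `N = Gal(ℚ̄/ℚ(μ_ℓ))`.**  If `τq ∈ I_{ℚ_q}`
restricts
to an element `σ` whose powers `σ^i`, `i < n`, cover `Γ_ℚ ⧸ N`, then some arithmetic Frobenius `r`
of `ℚ_q` has `res r ∈ N`: correct any Frobenius `r₀` by the power `(τq^i)⁻¹` with `(σ^i)⁻¹ · res r₀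
∈ N`; an inertia element times a Frobenius is a Frobenius (`IsFrobPow.inertia_mul`). [cite:
TateCorvallis1979, §1.4 (1.4.1)] -/
theorem exists_isAbsArithFrob_absGaloisRestrict_mem (q : HeightOneSpectrum (𝓞 ℚ))
    (N : Subgroup (absoluteGaloisGroup ℚ)) {σ : absoluteGaloisGroup ℚ} {n : ℕ}
    (hcov : ∀ g : absoluteGaloisGroup ℚ, ∃ i < n, (σ ^ i)⁻¹ * g ∈ N)
    {τq : absoluteGaloisGroup (q.adicCompletion ℚ)} (hτq : τq ∈ absInertia (q.adicCompletion ℚ))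
    (hτqσ : absGaloisRestrict ℚ (q.adicCompletion ℚ) τq = σ) :
    ∃ r : absoluteGaloisGroup (q.adicCompletion ℚ), IsAbsArithFrob r ∧
      absGaloisRestrict ℚ (q.adicCompletion ℚ) r ∈ N := by
  obtain ⟨r₀, hr₀⟩ := exists_isAbsArithFrob_holds (q.adicCompletion ℚ)
  obtain ⟨i, -, hi⟩ := hcov (absGaloisRestrict ℚ (q.adicCompletion ℚ) r₀)
  refine ⟨(τq ^ i)⁻¹ * r₀, ?_, ?_⟩
  · have h1 : IsFrobPow r₀ 1 := IsAbsArithFrob.isFrobPow_holds hr₀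
    have h2 : IsFrobPow ((τq ^ i)⁻¹ * r₀) 1 :=
      IsFrobPow.inertia_mul_holds (Subgroup.inv_mem _ (Subgroup.pow_mem _ hτq i)) h1
    exact isFrobPow_one_iff_isAbsArithFrob_holds.mp h2
  · rw [map_mul, map_inv, map_pow, hτqσ]
    exact hi

/-- **The mod-`ℓ` cyclotomic character of `τq` generates `(ℤ/ℓ)ˣ`** (koly's binder `hgen` of
`LocalSplitPrime.exists_unit_qTermIdentity` / `convCoeff_eq_zero_of_transverse_of_unramified`) as
soon as `res τq = σ` and the powers of `σ` cover `Γ_ℚ ⧸ Gal(ℚ̄/ℚ(μ_ℓ))`: every unit is `χ̄_ℓ(g)` for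
an inertial `g` (`exists_mem_inertia_modNCyclotomicCharacter_eq_of_mem_primesAbove`), `g ∈ σ^i·N`,
`N = ker χ̄_ℓ`, and the local and global characters agree along `res`. [cite: Rubin2000, §4.4 (the
choice of σ_ℓ)] -/
theorem forall_mem_zpowers_modPCyclotomicCharacterZMod_of_cov (q : HeightOneSpectrum (𝓞 ℚ))
    [Fact (((primesEquiv q : Nat.Primes) : ℕ)).Prime]
    [NeZero ((((primesEquiv q : Nat.Primes) : ℕ) : ℕ) : q.adicCompletion ℚ)]
    {σ : absoluteGaloisGroup ℚ} {n : ℕ}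
    (hcov : ∀ g : absoluteGaloisGroup ℚ, ∃ i < n,
      (σ ^ i)⁻¹ * g ∈ rootsOfUnityFixer ℚ ((primesEquiv q : Nat.Primes) : ℕ))
    {τq : absoluteGaloisGroup (q.adicCompletion ℚ)}
    (hτqσ : absGaloisRestrict ℚ (q.adicCompletion ℚ) τq = σ) :
    ∀ u : (ZMod ((primesEquiv q : Nat.Primes) : ℕ))ˣ,
      u ∈ Subgroup.zpowers (modPCyclotomicCharacterZMod (q.adicCompletion ℚ)
        ((primesEquiv q : Nat.Primes) : ℕ) τq) := by
  set ℓ : ℕ := ((primesEquiv q : Nat.Primes) : ℕ) with hℓ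
  haveI : NeZero ℓ := ⟨(Fact.out : ℓ.Prime).ne_zero⟩
  haveI : NeZero (ℓ : ℚ) := ⟨Nat.cast_ne_zero.mpr (Fact.out : ℓ.Prime).ne_zero⟩
  intro u
  obtain ⟨g, -, hg⟩ := exists_mem_inertia_modNCyclotomicCharacter_eq_of_mem_primesAbove q
    (adicCompletionPrime_mem_primesAbove ℚ q) u
  obtain ⟨i, -, hi⟩ := hcov g
  rw [rootsOfUnityFixer_eq_ker, MonoidHom.mem_ker, map_mul, map_inv, map_pow, hg,
    inv_mul_eq_one] at hi
  rw [Subgroup.mem_zpowers_iff]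
  refine ⟨(i : ℤ), ?_⟩
  rw [zpow_natCast, modPCyclotomicCharacterZMod_eq_modNCyclotomicCharacter,
    ← modNCyclotomicCharacter_absGaloisRestrict ℚ (q.adicCompletion ℚ) ℓ τq, hτqσ]
  exact hi

/-- **THE KOLYVAGIN COCYCLE AT THE MEETING POINT, WITH ITS VALUE** (MU-TRANSFER-PROOF §3 Lemma 2 +
(3.1)
+ §5 STEP 3).  Data: `p` odd; `κ`, `ρ` over `ℚ` with `p·M = 0` and `M^{Gal(ℚ̄/ℚ(μ_ℓ))} = 0`; the
Chebotarev place `q` (prime `ℓ`, `ρ` unramified at `q`, `q ∤ p`, `p ∣ ℓ − 1`); levels `J ≤ L`; a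
tame cocycle `y'` on `N = Gal(ℚ̄/ℚ(μ_ℓ))` with values in `𝒯_L` that is UNRAMIFIED AT EVERY PRIME `𝔓
∤ p` (Kato integrality, level `L`); a global cocycle `ψ'` of `𝒯_L` with the CLASS-LEVEL norm
relation `cor_N [y'] = [ψ']` whose truncation to level `J` vanishes (the Euler factor `P ∈
T^{J}·A_L`).  Output: a tame generator `σ ∈ ℐ_{𝔓₀}`, a local inertia element `τq` over it WHOSE
mod-`ℓ` CYCLOTOMIC CHARACTER GENERATES, `σ` trivial on `𝒯_J`, the Kolyvagin cocycle `Φ` of the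
truncated class `y = y' mod T^J` with **`hx`** (unramified at `w ≠ q`, `w ∤ p`, `ρ` unramified at
`w`) and **`loc_q [Φ] ∈ H¹_tr`**, a local Frobenius **`r` with `res r ∈ N`**, and THE KEY RELATION
**`Φ(res τq) = −(a' mod T^J)`, `(res r)·a' − a' = −ψ'(res r)`** for a level-`L` norm witness `a'`.
[cite: Rubin2000, Def. 4.4.4, Lemma 4.4.2 and Thm. 4.5.1] [cite: PerrinRiou1998AIF, §3.1.2 and Prop.
3.1.6] -/
theorem exists_kolyvaginCocycle_value (hp2 : p ≠ 2) (q : HeightOneSpectrum (𝓞 ℚ))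
    [NeZero ((primesEquiv q : Nat.Primes) : ℕ)] [Fact (((primesEquiv q : Nat.Primes) : ℕ)).Prime]
    [NeZero ((((primesEquiv q : Nat.Primes) : ℕ) : ℕ) : q.adicCompletion ℚ)]
    [hNn : (rootsOfUnityFixer ℚ ((primesEquiv q : Nat.Primes) : ℕ)).Normal]
    [Fintype (absoluteGaloisGroup ℚ ⧸ rootsOfUnityFixer ℚ ((primesEquiv q : Nat.Primes) : ℕ))]
    (hfix : ∀ m : M,
      (∀ g ∈ rootsOfUnityFixer ℚ ((primesEquiv q : Nat.Primes) : ℕ), ρ g m = m) → m = 0)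
    (hpq : (p : 𝓞 ℚ) ∉ q.asIdeal) (hunr : GaloisRep.IsUnramifiedAt q ρ)
    (hdvd : p ∣ ((primesEquiv q : Nat.Primes) : ℕ) - 1)
    {L : ℕ} (hJL : J ≤ L)
    (y' : contOneCocycles (subgroupRep (κ.twistModP ρ hM L).toTopRep
      (rootsOfUnityFixer ℚ ((primesEquiv q : Nat.Primes) : ℕ))))
    (hyI' : ∀ w : HeightOneSpectrum (𝓞 ℚ), (p : 𝓞 ℚ) ∉ w.asIdeal → ∀ 𝔓 ∈ w.primesAbove,
      resLe (κ.twistModP ρ hM L).toTopRep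
        (inf_le_left : rootsOfUnityFixer ℚ ((primesEquiv q : Nat.Primes) : ℕ) ⊓
          𝔓.inertia (absoluteGaloisGroup ℚ) ≤ _) 1 (oneCocycleClass _ y') = 0)
    (ψ' : contOneCocycles (κ.twistModP ρ hM L).toTopRep)
    (hnorm : cores (κ.twistModP ρ hM L).toTopRep
        (rootsOfUnityFixer ℚ ((primesEquiv q : Nat.Primes) : ℕ))
        (isOpen_rootsOfUnityFixer ℚ _) (oneCocycleClass _ y') = oneCocycleClass _ ψ')
    (hψJ : ∀ (g : absoluteGaloisGroup ℚ) (i : Fin J), ψ'.1 g (Fin.castLE hJL i) = 0) :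
    ∃ σ ∈ (adicCompletionPrime ℚ q).inertia (absoluteGaloisGroup ℚ),
      ∃ τq ∈ absInertia (q.adicCompletion ℚ),
      absGaloisRestrict ℚ (q.adicCompletion ℚ) τq = σ ∧
      (∀ u : (ZMod ((primesEquiv q : Nat.Primes) : ℕ))ˣ,
        u ∈ Subgroup.zpowers (modPCyclotomicCharacterZMod (q.adicCompletion ℚ)
          ((primesEquiv q : Nat.Primes) : ℕ) τq)) ∧
      (∀ x : Fin J → M, κ.twistModP ρ hM J σ x = x) ∧
      ∃ Φ : contOneCocycles (κ.twistModP ρ hM J).toTopRep,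
        (∀ w : HeightOneSpectrum (𝓞 ℚ), w ≠ q → (p : 𝓞 ℚ) ∉ w.asIdeal →
          GaloisRep.IsUnramifiedAt w ρ →
          galoisCohomology.localization (κ.twistModP ρ hM J) (Sum.inr w) 1 (oneCocycleClass _ Φ) ∈
            DiscreteGaloisModule.unramifiedSubgroup (GaloisRep.toLocal w (κ.twistModP ρ hM J)) 1) ∧
        galoisCohomology.localization (κ.twistModP ρ hM J) (Sum.inr q) 1 (oneCocycleClass _ Φ) ∈
          DiscreteGaloisModule.transverseSubgroup (GaloisRep.toLocal q (κ.twistModP ρ hM J))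
            (CyclotomicField ((primesEquiv q : Nat.Primes) : ℕ) (q.adicCompletion ℚ)) ∧
        ∃ r : absoluteGaloisGroup (q.adicCompletion ℚ), IsAbsArithFrob r ∧
          absGaloisRestrict ℚ (q.adicCompletion ℚ) r ∈
            rootsOfUnityFixer ℚ ((primesEquiv q : Nat.Primes) : ℕ) ∧
          ∃ a' : Fin L → M,
            (Φ.1 (absGaloisRestrict ℚ (q.adicCompletion ℚ) τq) = fun i => -a' (Fin.castLE hJL i)) ∧
            κ.twistModP ρ hM L (absGaloisRestrict ℚ (q.adicCompletion ℚ) r) a' - a' =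
              -ψ'.1 (absGaloisRestrict ℚ (q.adicCompletion ℚ) r) := by
  have h𝔓₀ := adicCompletionPrime_mem_primesAbove ℚ q
  -- the generator
  obtain ⟨σ, hσI, hσn, hcov, hinj⟩ := exists_generator_mem_inertia q h𝔓₀
  -- inertia of `𝔓₀` acts trivially, at both levels
  have hIL : ∀ τ ∈ (adicCompletionPrime ℚ q).inertia (absoluteGaloisGroup ℚ), ∀ w : Fin L → M,
      (κ.twistModP ρ hM L).toTopRep.ρ τ w = w := fun τ hτ w =>
    twistModP_apply_eq_self_of_mem_inertia κ ρ hM L hpq hunr h𝔓₀ hτ w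
  have hIJ : ∀ τ ∈ (adicCompletionPrime ℚ q).inertia (absoluteGaloisGroup ℚ), ∀ w : Fin J → M,
      (κ.twistModP ρ hM J).toTopRep.ρ τ w = w := fun τ hτ w =>
    twistModP_apply_eq_self_of_mem_inertia κ ρ hM J hpq hunr h𝔓₀ hτ w
  have hσL : ∀ w : Fin L → M, (κ.twistModP ρ hM L).toTopRep.ρ σ w = w := hIL σ hσI
  have hσJ : ∀ w : Fin J → M, (κ.twistModP ρ hM J).toTopRep.ρ σ w = w := hIJ σ hσI
  -- `X_J^N = 0`, `(ℓ - 1) • X = 0` at both levels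
  have h0 := twistModP_eq_zero_of_forall_rootsOfUnityFixer κ ρ hM J _ hfix
  have hnXJ : ∀ w : Fin J → M, ((((primesEquiv q : Nat.Primes) : ℕ) - 1 : ℕ) : ℤ) • w = 0 :=
    fun w => by rw [natCast_zsmul]; exact LocalSplitPrime.sub_one_smul_eq_zero_of_dvd hM hdvd w
  have hnXL : ∀ w : Fin L → M, ((((primesEquiv q : Nat.Primes) : ℕ) - 1 : ℕ) : ℤ) • w = 0 :=
    fun w => by rw [natCast_zsmul]; exact LocalSplitPrime.sub_one_smul_eq_zero_of_dvd hM hdvd w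
  -- `y'` vanishes on `N ∩ ℐ_{𝔓₀}`
  have hy'τ := apply_eq_zero_of_resLe_inf_eq_zero _ _
    ((adicCompletionPrime ℚ q).inertia (absoluteGaloisGroup ℚ)) hIL y' (hyI' q hpq _ h𝔓₀)
  -- the level-`L` norm witness `a'` from the CLASS-LEVEL norm relation
  have h𝒩' : ∑ i ∈ range (((primesEquiv q : Nat.Primes) : ℕ) - 1),
      conjMap (κ.twistModP ρ hM L).toTopRep (rootsOfUnityFixer ℚ ((primesEquiv q : Nat.Primes) : ℕ))
        (σ ^ i) 1 (oneCocycleClass _ y') =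
      resSubgroup (κ.twistModP ρ hM L).toTopRep
        (rootsOfUnityFixer ℚ ((primesEquiv q : Nat.Primes) : ℕ)) 1 (oneCocycleClass _ ψ') := by
    rw [sum_conjMap_pow_eq_resSubgroup_cores _ _ (isOpen_rootsOfUnityFixer ℚ _) hcov hinj, hnorm]
  obtain ⟨a', ha'⟩ := exists_norm_witness_of_sum_conjMap_eq_resSubgroup _ _ σ _ y' ψ' h𝒩'
  -- truncation `π : 𝒯_L → 𝒯_J`, the truncated cocycle `y = π ∘ y'`
  let π : (κ.twistModP ρ hM L).toTopRep ⟶ (κ.twistModP ρ hM J).toTopRep :=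
    TopRep.ofHom ⟨(κ.twistModPTruncate ρ hM L hJL).toContinuousLinearMap,
      (κ.twistModPTruncate ρ hM L hJL).isIntertwining'⟩
  have hπ : ∀ x : Fin L → M, π.hom x = fun i => x (Fin.castLE hJL i) := fun _ => rfl
  let y : contOneCocycles (subgroupRep (κ.twistModP ρ hM J).toTopRep
      (rootsOfUnityFixer ℚ ((primesEquiv q : Nat.Primes) : ℕ))) :=
    contOneCocycles.pullback (ContinuousMonoidHom.id _)
      (Y := subgroupRep (κ.twistModP ρ hM J).toTopRep
        (rootsOfUnityFixer ℚ ((primesEquiv q : Nat.Primes) : ℕ)))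
      (TopRep.ofHom ⟨π.hom.toContinuousLinearMap, fun g =>
        π.hom.isIntertwining' (g : absoluteGaloisGroup ℚ)⟩) y'
  have hy : ∀ u, y.1 u = π.hom (y'.1 u) := fun _ => rfl
  -- the transported norm witness `a = π a'` (the truncation of `ψ'` vanishes): `𝒩y = ∂(π a')`
  have ha : ∀ u : rootsOfUnityFixer ℚ ((primesEquiv q : Nat.Primes) : ℕ),
      ∑ i ∈ range (((primesEquiv q : Nat.Primes) : ℕ) - 1),
        (κ.twistModP ρ hM J).toTopRep.ρ (σ ^ i) (y.1 (subgroupConj _ (σ ^ i) u)) =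
      (κ.twistModP ρ hM J).toTopRep.ρ (u : absoluteGaloisGroup ℚ) (π.hom a') - π.hom a' := by
    intro u
    have h := norm_witness_map _ _ π σ _ y' (fun u => ψ'.1 u) a' ha' u
    have hψ : π.hom (ψ'.1 u) = 0 := by
      rw [hπ]; funext i; exact hψJ _ i
    rw [hψ, zero_add] at h
    exact h
  -- `y` vanishes on `N ∩ ℐ_{𝔓₀}`, in particular at `σ^{ℓ-1}`
  have hyτ : ∀ τ : rootsOfUnityFixer ℚ ((primesEquiv q : Nat.Primes) : ℕ),
      (τ : absoluteGaloisGroup ℚ) ∈ (adicCompletionPrime ℚ q).inertia (absoluteGaloisGroup ℚ) →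
        y.1 τ = 0 := fun τ hτ => by
    rw [hy, hy'τ τ hτ, map_zero]
  have hyσn : y.1 ⟨σ ^ (((primesEquiv q : Nat.Primes) : ℕ) - 1), hσn⟩ = 0 :=
    hyτ ⟨_, hσn⟩ (Subgroup.pow_mem _ hσI _)
  have hgen : ∀ g : absoluteGaloisGroup ℚ, ∃ i : ℕ,
      (σ ^ i)⁻¹ * g ∈ rootsOfUnityFixer ℚ ((primesEquiv q : Nat.Primes) : ℕ) := fun g => by
    obtain ⟨i, -, hi⟩ := hcov g; exact ⟨i, hi⟩
  -- the Kolyvagin cocycle of `y` (Lemma 2), value `Φ(σ) = −π a'`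
  obtain ⟨Φ, hΦN, hΦσ, -, -⟩ := exists_kolyvaginCocycle _ _ (isOpen_rootsOfUnityFixer ℚ _)
    h0 hσJ hσn hgen hnXJ y hyσn (π.hom a') ha
  -- a local inertia element `τq` over `σ`, a local Frobenius `r` restricting into `N`
  have hσ' : σ ∈ (absInertia (q.adicCompletion ℚ)).map
      (absGaloisRestrict ℚ (q.adicCompletion ℚ)).toMonoidHom := by
    rw [← inertia_adicCompletionPrime_eq_map_absInertia]; exact hσI
  obtain ⟨τq, hτq, hτqσ⟩ := Subgroup.mem_map.mp hσ'
  obtain ⟨r, hr, hrN⟩ := exists_isAbsArithFrob_absGaloisRestrict_mem q _ hcov hτq hτqσ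
  refine ⟨σ, hσI, τq, hτq, hτqσ,
    forall_mem_zpowers_modPCyclotomicCharacterZMod_of_cov q hcov hτqσ, hσJ, Φ,
    fun w hwq hwp hwunr => ?_, ?_, r, hr, hrN, a', ?_, ?_⟩
  · -- `hx`: unramified at `w ≠ q`, `w ∤ p` (as in p458422, for `y = π ∘ y'`)
    have hwN : ∀ 𝔓 ∈ w.primesAbove, 𝔓.inertia (absoluteGaloisGroup ℚ) ≤
        rootsOfUnityFixer ℚ ((primesEquiv q : Nat.Primes) : ℕ) :=
      rootsOfUnityFixer_unramifiedAt_of_not_mem ℚ _ (natCast_primesEquiv_not_mem_of_ne hwq)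
    have hXw : ∀ 𝔓 ∈ w.primesAbove, ∀ τ ∈ 𝔓.inertia (absoluteGaloisGroup ℚ),
        ∀ x : (κ.twistModP ρ hM L).toTopRep, (κ.twistModP ρ hM L).toTopRep.ρ τ x = x :=
      fun 𝔓 h𝔓 τ hτ x => twistModP_apply_eq_self_of_mem_inertia κ ρ hM L hwp hwunr h𝔓 hτ x
    have hy'w := forall_primesAbove_apply_eq_zero_of_resLe_inf_eq_zero _ _ hwN hXw y' (hyI' w hwp)
    have hyw : ∀ 𝔓 (h𝔓 : 𝔓 ∈ w.primesAbove) (τ : absoluteGaloisGroup ℚ)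
        (hτ : τ ∈ 𝔓.inertia (absoluteGaloisGroup ℚ)), y.1 ⟨τ, hwN 𝔓 h𝔓 hτ⟩ = 0 :=
      fun 𝔓 h𝔓 τ hτ => by rw [hy, hy'w 𝔓 h𝔓 τ hτ, map_zero]
    exact localization_mem_unramifiedSubgroup_of_forall_inertia_apply_eq_zero (κ.twistModP ρ hM J)
      w Φ fun τ hτ => derivCocycle_apply_eq_zero_of_forall_primesAbove _ _ hwN σ _ y hyw Φ hΦN
        (adicCompletionPrime_mem_primesAbove ℚ w) hτ
  · -- transverse at `q`: `Φ` vanishes at the `ℐ_{𝔓₀}`-normalising elements of `N`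
    refine localization_mem_transverseSubgroup_of_forall_apply_eq_zero (κ.twistModP ρ hM J) q _ Φ
      fun φ hφN hφ => ?_
    have hkill : ∀ i : ℕ,
        y.1 ((⟨φ, hφN⟩ : rootsOfUnityFixer ℚ ((primesEquiv q : Nat.Primes) : ℕ))⁻¹ *
          subgroupConj _ (σ ^ i) ⟨φ, hφN⟩) = 0 := fun i =>
      hyτ _ (inv_mul_conj_mem_of_normalises
        ((adicCompletionPrime ℚ q).inertia (absoluteGaloisGroup ℚ)) hφ hσI i)
    rw [derivCocycle_apply_eq_sum_smul _ _ hσJ _ y Φ hΦN ⟨φ, hφN⟩ hkill]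
    exact sum_range_natCast_zsmul_eq_zero J hM hp2 hdvd _
  · -- the value at `res τq = σ`: `Φ(σ) = −π a'`
    change Φ.1 ((absGaloisRestrict ℚ (q.adicCompletion ℚ)).toMonoidHom τq) = _
    rw [hτqσ, hΦσ, hπ]
    funext i
    rw [Pi.neg_apply]
  · -- the key relation (3.1) at the Frobenius `φ = res r ∈ N`
    have hkill : ∀ i : ℕ,
        y'.1 ((⟨_, hrN⟩ : rootsOfUnityFixer ℚ ((primesEquiv q : Nat.Primes) : ℕ))⁻¹ *
          subgroupConj _ (σ ^ i) ⟨_, hrN⟩) = 0 := fun i =>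
      hy'τ _ (inv_mul_conj_mem_of_normalises
        ((adicCompletionPrime ℚ q).inertia (absoluteGaloisGroup ℚ))
        (fun τ hτ => absGaloisRestrict_normalises_inertia_adicCompletionPrime q r hτ) hσI i)
    have h := rho_sub_eq_of_norm_witness _ _ hσL _ y' (fun u => ψ'.1 u) a' ha' ⟨_, hrN⟩ hkill
    have hn0 : (((primesEquiv q : Nat.Primes) : ℕ) - 1) •
        y'.1 ⟨absGaloisRestrict ℚ (q.adicCompletion ℚ) r, hrN⟩ = 0 := by
      have := hnXL (y'.1 ⟨absGaloisRestrict ℚ (q.adicCompletion ℚ) r, hrN⟩)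
      rwa [natCast_zsmul] at this
    rw [hn0, zero_sub, toTopRep_twistModP_ρ_apply] at h
    exact h

end Summit.BirchSwinnertonDyer.BirchSwinnertonDyer.Rank1Residual.KolyvaginTwist

end
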